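import Summits.BirchSwinnertonDyer.Rank1Residual.X11b.LocSurjFromLevels
import Literature.NumberTheory.EllipticCurves.LocalEulerCharacteristicTorsion
import Literature.NumberTheory.EllipticCurves.IwasawaSelmerControlAwayFromPProofs
import Literature.NumberTheory.EllipticCurves.IwasawaSelmerSupersingularLocalProofs
import Literature.NumberTheory.EllipticCurves.PointDivisibilityProofs
import HarnessLib

/-!
# X11b, route R1 — `H¹(K_v, E[p^∞])` is FINITE at a finite place `v ∤ p` (Lutz–Mattuck + local
# Euler characteristic): the local finiteness input of the (P9) argument

HONEST FRAMING (cell `b2b-bsdres`, run/shared/lean/b2b/bsd-rank1-residual/, verbatim in every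
file): the goal of the cell is to DELETE the COMBINATION-SHAPED residual classes of the
Birch–Swinnerton-Dyer formula for ALL analytic-rank `≤ 1` elliptic curves over `ℚ` — "full BSD
formula for every rank `≤ 1` curve in class `C`" assembled STRICTLY from published theorems — so
that the rank-`≤ 1` remainder becomes exactly the CONSTRUCTION-SHAPED classes, which are TYPED
(missing-input `Prop`s), NOT attempted. This is not "finishing BSD". Sub-cell
`b2b-bsdres-multr1-p1` (X11b, route R1 = Castella 2018 Thm. A re-proved along the author's
erratum); a RESEARCH ROUTE; no claim beyond the stated class; X11b stays CONSTRUCTION-SHAPED;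
nothing here changes a label; no named fact is minted (theorems only; no `sorry`).  The main
theorem is CONDITIONAL on the tree's cited named fact `localEulerPoincareCharacteristic (K_v)`
(Milne ADT I Thm. 2.8, taken as a hypothesis `hEP`).

## What is here (Greenberg LNM 1716 §3, proof of Lemma 3.3: "`H¹(K_v, E[p^∞])` is finite … its
## order is bounded in terms of `E(K_v)_{p^∞}`"; JSW17 §2.2.2)

At a finite place `v ∤ p` of a number field `K`, for an elliptic curve `E/K`:

* `finite_setOf_fixed_primary_localPoints`: the `Γ_{K_v}`-fixed `p`-power torsion of `E(K̄_v)` is a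
  finite set — the tree's Lutz–Mattuck finiteness (`finite_setOf_forall_map_eq_and_nsmul_eq_zero`,
  Silverman VII.3.1 / VII.6.2) transported from the minimal model along `localPointsEquivModel`;
* `finite_setOf_fixed_geomPrimaryTorsion`: hence the `Γ_{K_v}`-fixed part of `E[p^∞](K̄)` (the
  module `E[p^∞]|_{Γ_{K_v}}` of the Selmer structures) is finite (embedding `E(K̄) ↪ E(K̄_v)`);
* `natCard_invariants_torsion_le`: `#(E[p^k]|_{Γ_{K_v}})^{Γ_{K_v}} ≤ B` uniformly in `k`
  (`B` = the size of that finite set);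
* `natCard_galoisCohomology_one_torsion_le` (under `hEP`): `#H¹(K_v, E[p^k]) ≤ B²` for `k ≥ 1`
  (`#H¹ = (#H⁰ · #𝓞_v/p^k)²`, tree `natCard_galoisCohomology_one_torsion_adicCompletion_eq_sq`;
  `p^k ∈ 𝓞_v^×`);
* **`finite_galoisCohomology_one_primary_toLocal`** (under `hEP`): `H¹(K_v, E[p^∞])` is finite —
  every class is killed by some `p^k` and then comes from the finite `H¹(K_v, E[p^k])` of size `≤ B²`,
  so no `B² + 1` classes are distinct.

With `RelaxedSelmerFinite` this reduces the finiteness input of `levelLiftingAt_of_finite` (P9) to the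
finiteness of Castella's unrelaxed conjugate group `Sel_𝔮(K, E[p^∞])` and the cited Milne I 2.8.

References: [GreenbergLNM1716] §3 Lemma 3.3 (p. 87); [SilvermanAEC2009] VII.3.1, VII.6.2/6.3;
[MilneADT2006] I Thm. 2.8, I §3 Lemma 3.3; [JetchevSkinnerWan2017] §2.2.2.
-/

noncomputable section

open scoped Classical

open Field NumberField IsDedekindDomain
open Literature.NumberTheory.EllipticCurves
open Literature.NumberTheory.GaloisRepresentations
open scoped ContRepresentation

universe u

namespace Summit.BirchSwinnertonDyer.Rank1Residual.X11b.LocBridge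

open Summit.BirchSwinnertonDyer.Rank1Residual.X11b.Levels

variable {K : Type u} [Field K] [NumberField K] (W : WeierstrassCurve K) [W.IsElliptic] (p : ℕ)
  [Fact p.Prime] (v : HeightOneSpectrum (𝓞 K))

/-! ## §1. Lutz–Mattuck: the Galois-fixed `p`-power torsion of `E(K̄_v)` and of `E[p^∞](K̄)` is finite -/

omit [Fact p.Prime] in
/-- **The `Γ_{K_v}`-fixed `p`-power torsion points of `E(K̄_v)` form a finite set** (`v ∤ p`): the
tree's Lutz–Mattuck finiteness on the minimal model at `v` (`finite_setOf_forall_map_eq_and_nsmul_eq_zero`: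
`E₁(K_v)` has finite index and no `p`-torsion), transported along the `Γ_{K_v}`-equivariant
`localPointsEquivModel`. [cite: SilvermanAEC2009, Prop. VII.3.1 and Cor. VII.6.2]
[cite: GreenbergLNM1716, §3 Lemma 3.3 (proof, p. 87)] -/
theorem finite_setOf_fixed_primary_localPoints (hpv : (p : 𝓞 K) ∉ v.asIdeal) :
    Set.Finite {X : localPoints W (v.adicCompletion K) |
      (∀ σ : absoluteGaloisGroup (v.adicCompletion K), σ • X = X) ∧ ∃ k : ℕ, p ^ k • X = 0} := by
  obtain ⟨w, hw⟩ := v.exists_spectralValuation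
  have hp : IsUnit ((p : ℕ) : v.adicCompletionIntegers K) := by
    have h := IsDedekindDomain.HeightOneSpectrum.isUnit_algebraMap_adicCompletionIntegers K v hpv
    rwa [map_natCast] at h
  have hS := W.finite_setOf_forall_map_eq_and_nsmul_eq_zero hw hp (v := v)
  refine (hS.preimage (W.localPointsEquivModel v).injective.injOn).subset fun X hX ↦ ?_
  refine ⟨fun σ ↦ ?_, ?_⟩
  · rw [← WeierstrassCurve.localPointsEquivModel_smul, hX.1 σ]
  · obtain ⟨k, hk⟩ := hX.2
    exact ⟨k, by rw [← map_nsmul, hk, map_zero]⟩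

omit [Fact p.Prime] in
/-- **The `Γ_{K_v}`-fixed part of `E[p^∞](K̄)` is finite** (`v ∤ p`; `Γ_{K_v}` acting through
`Γ_{K_v} → Γ_K` on the restricted module `E[p^∞]|_{Γ_{K_v}}`): push along the equivariant injection
`E(K̄) ↪ E(K̄_v)` of the chosen embedding (`pointsMapOfEmb`, `pointsMapOfEmb_smul`) into the finite
set of `finite_setOf_fixed_primary_localPoints`. [cite: GreenbergLNM1716, §3 Lemma 3.3 (proof, p. 87)] -/
theorem finite_setOf_fixed_geomPrimaryTorsion (hpv : (p : 𝓞 K) ∉ v.asIdeal) :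
    Set.Finite {Q : W.geomPrimaryTorsion p | ∀ σ : absoluteGaloisGroup (v.adicCompletion K),
      GaloisRep.restrictField (v.adicCompletion K) (primaryGaloisModule W p) σ Q = Q} := by
  let f : W.geomPrimaryTorsion p → localPoints W (v.adicCompletion K) := fun Q ↦
    pointsMapOfEmb W (closureEmb (K := K) (v.adicCompletion K)) (Q : W.geomPoints)
  have hf : Function.Injective f := fun Q Q' h ↦
    Subtype.ext (pointsMapOfEmb_injective W (closureEmb (K := K) (v.adicCompletion K)) h)
  refine ((finite_setOf_fixed_primary_localPoints W p v hpv).preimage hf.injOn).subset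
    fun Q hQ ↦ ?_
  refine ⟨fun σ ↦ ?_, ?_⟩
  · have h1 : resGalOfEmb (closureEmb (K := K) (v.adicCompletion K)) σ • (Q : W.geomPoints) = Q :=
      congrArg (fun x : W.geomPrimaryTorsion p ↦ (x : W.geomPoints)) (hQ σ)
    change σ • pointsMapOfEmb W _ (Q : W.geomPoints) = pointsMapOfEmb W _ (Q : W.geomPoints)
    rw [← pointsMapOfEmb_smul, h1]
  · obtain ⟨k, hk⟩ := AddCommGroup.mem_primaryComponent.mp Q.2
    refine ⟨k, ?_⟩
    change p ^ k • pointsMapOfEmb W _ (Q : W.geomPoints) = 0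
    rw [← map_nsmul, hk, map_zero]

omit [Fact p.Prime] in
/-- **`#H⁰(K_v, E[p^k]) ≤ B_v := #(E[p^∞](K̄)^{Γ_{K_v}})` uniformly in `k`** (`E[p^k] ↪ E[p^∞]`).
[cite: GreenbergLNM1716, §3 Lemma 3.3 (p. 87)] -/
theorem natCard_invariants_torsion_le (hpv : (p : 𝓞 K) ∉ v.asIdeal) (k : ℕ) :
    Nat.card (GaloisRep.restrictField (v.adicCompletion K)
        (W.torsionGaloisModule ((p ^ k : ℕ) : ℤ))).toTopRep.ρ.invariants ≤
      Nat.card {Q : W.geomPrimaryTorsion p | ∀ σ : absoluteGaloisGroup (v.adicCompletion K),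
        GaloisRep.restrictField (v.adicCompletion K) (primaryGaloisModule W p) σ Q = Q} := by
  haveI := (finite_setOf_fixed_geomPrimaryTorsion W p v hpv).to_subtype
  refine Nat.card_le_card_of_injective (fun Q ↦ ⟨primaryInclusion W p k Q.1, fun σ ↦ ?_⟩) ?_
  · have hQ := (Representation.mem_invariants _ Q.1).mp Q.2 σ
    have hi := ((primaryInclusion W p k).restrictField (v.adicCompletion K)).isIntertwining σ Q.1
    rw [ContinuousRep.toContRepresentation_apply_apply,
      ContinuousRep.toContRepresentation_apply_apply] at hi
    exact hi.symm.trans (congrArg _ hQ)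
  · intro Q Q' h
    exact Subtype.ext (primaryInclusion_injective W p k (congrArg Subtype.val h))

/-! ## §2. `#H¹(K_v, E[p^k]) ≤ B²` uniformly, from the local Euler characteristic -/

omit [W.IsElliptic] [Fact p.Prime] in
/-- `#(𝓞_v ⧸ p^k) = 1` for `v ∤ p` (`p^k` is a unit of `𝓞_v`). [folklore] -/
theorem natCard_quotient_span_pow_eq_one (hpv : (p : 𝓞 K) ∉ v.asIdeal) (k : ℕ) :
    Nat.card (v.adicCompletionIntegers K ⧸
      Ideal.span {((p ^ k : ℕ) : v.adicCompletionIntegers K)}) = 1 := by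
  have hp : IsUnit ((p : ℕ) : v.adicCompletionIntegers K) := by
    have h := IsDedekindDomain.HeightOneSpectrum.isUnit_algebraMap_adicCompletionIntegers K v hpv
    rwa [map_natCast] at h
  have htop : Ideal.span {((p ^ k : ℕ) : v.adicCompletionIntegers K)} = ⊤ := by
    rw [Ideal.span_singleton_eq_top, Nat.cast_pow]
    exact hp.pow k
  haveI : Subsingleton (v.adicCompletionIntegers K ⧸
      Ideal.span {((p ^ k : ℕ) : v.adicCompletionIntegers K)}) :=
    Ideal.Quotient.subsingleton_iff.mpr htop
  exact Nat.card_of_subsingleton 0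

-- `H²` needs `LocallyCompactSpace Γ`; compactness of absolute Galois groups as a local instance.
attribute [local instance] absoluteGaloisGroup_compactSpace

/-- **`#H¹(K_v, E[p^k]) ≤ B_v²` for every `k ≥ 1`** (`v ∤ p`), from Milne I Thm. 2.8 at `K_v` (cited,
hypothesis `hEP`) in the tree's form `#H¹(K_v, E[n]) = (#E(K_v)[n] · #(𝓞_v/n))²`
(`natCard_galoisCohomology_one_torsion_adicCompletion_eq_sq`, with `#E(K_v)[n] = #H⁰`), `#(𝓞_v/p^k) = 1`,
and `#H⁰(K_v, E[p^k]) ≤ B_v`. [cite: MilneADT2006, Ch. I §2 Thm. 2.8 and §3 Lemma 3.3]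
[cite: GreenbergLNM1716, §3 Lemma 3.3 (p. 87)] -/
theorem natCard_galoisCohomology_one_torsion_le (hEP : localEulerPoincareCharacteristic (v.adicCompletion K))
    (hpv : (p : 𝓞 K) ∉ v.asIdeal) {k : ℕ} (hk : k ≠ 0) :
    Nat.card (galoisCohomology
        (GaloisRep.restrictField (v.adicCompletion K) (W.torsionGaloisModule ((p ^ k : ℕ) : ℤ))) 1) ≤
      Nat.card {Q : W.geomPrimaryTorsion p | ∀ σ : absoluteGaloisGroup (v.adicCompletion K),
        GaloisRep.restrictField (v.adicCompletion K) (primaryGaloisModule W p) σ Q = Q} ^ 2 := by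
  haveI : NeZero (p ^ k) := ⟨pow_ne_zero k (Fact.out : p.Prime).ne_zero⟩
  haveI : CharZero (v.adicCompletion K) :=
    charZero_of_injective_algebraMap (algebraMap K (v.adicCompletion K)).injective
  have hpp : IsPrimePow (p ^ k) := (Fact.out : p.Prime).isPrimePow.pow hk
  rw [natCard_galoisCohomology_one_torsion_adicCompletion_eq_sq W v (p ^ k) hpp hEP,
    natCard_quotient_span_pow_eq_one p v hpv k, mul_one,
    ← natCard_invariants_torsion_restrictField W (v.adicCompletion K)
      (pow_ne_zero k (Fact.out : p.Prime).ne_zero)]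
  exact Nat.pow_le_pow_left (natCard_invariants_torsion_le W p v hpv k) 2

/-! ## §3. `H¹(K_v, E[p^∞])` is finite -/

/-- A finite set of classes of `H¹(K_v, E[p^∞])` killed by `p^k` (`k ≥ 1`) has at most `B_v²`
elements: they lie in the image of the finite `H¹(K_v, E[p^k])`
(`mem_range_map_primaryInclusion_restrictField_iff`). [cite: GreenbergLNM1716, §3 Lemma 3.3 (p. 87)] -/
theorem card_le_of_pow_nsmul_eq_zero (hEP : localEulerPoincareCharacteristic (v.adicCompletion K))
    (hpv : (p : 𝓞 K) ∉ v.asIdeal) {k : ℕ} (hk : k ≠ 0)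
    (s : Finset (galoisCohomology
      (GaloisRep.restrictField (v.adicCompletion K) (primaryGaloisModule W p)) 1))
    (hs : ∀ x ∈ s, p ^ k • x = 0) :
    s.card ≤ Nat.card {Q : W.geomPrimaryTorsion p | ∀ σ : absoluteGaloisGroup (v.adicCompletion K),
        GaloisRep.restrictField (v.adicCompletion K) (primaryGaloisModule W p) σ Q = Q} ^ 2 := by
  haveI : NeZero (p ^ k) := ⟨pow_ne_zero k (Fact.out : p.Prime).ne_zero⟩
  set f := galoisCohomology.map ((primaryInclusion W p k).restrictField (v.adicCompletion K)) 1
    with hf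
  -- the source `H¹(K_v, E[p^k])` is finite
  haveI hfinM : Finite (W.geomTorsion ((p ^ k : ℕ) : ℤ)) := finite_geomTorsion_of_neZero W (p ^ k)
  haveI : Finite (galoisCohomology
      (GaloisRep.restrictField (v.adicCompletion K) (W.torsionGaloisModule ((p ^ k : ℕ) : ℤ))) 1) :=
    (localEulerPoincareCharacteristic_adicCompletion K v hEP _).1
  have hsub : (s : Set _) ⊆ Set.range f := fun x hx ↦
    AddMonoidHom.mem_range.mp ((mem_range_map_primaryInclusion_restrictField_iff W p k
      (v.adicCompletion K) W.zsmul_geomPoints_surjective_holds x).mpr (hs x hx))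
  calc s.card = (s : Set _).ncard := (Set.ncard_coe_finset s).symm
    _ ≤ (Set.range f).ncard := Set.ncard_le_ncard hsub (Set.finite_range f)
    _ = (f '' Set.univ).ncard := by rw [Set.image_univ]
    _ ≤ (Set.univ : Set (galoisCohomology (GaloisRep.restrictField (v.adicCompletion K)
          (W.torsionGaloisModule ((p ^ k : ℕ) : ℤ))) 1)).ncard := Set.ncard_image_le Set.finite_univ
    _ = Nat.card (galoisCohomology
          (GaloisRep.restrictField (v.adicCompletion K) (W.torsionGaloisModule ((p ^ k : ℕ) : ℤ))) 1) :=
        Set.ncard_univ _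
    _ ≤ _ := natCard_galoisCohomology_one_torsion_le W p v hEP hpv hk

/-- **`H¹(K_v, E[p^∞])` is finite at every finite place `v ∤ p`** (Greenberg LNM 1716 §3, proof of
Lemma 3.3; JSW17 §2.2.2), GIVEN Milne I Thm. 2.8 at `K_v` (`hEP`, cited): every class is killed by a
power of `p` (compactness), so any `B_v² + 1` classes are killed by a common `p^k` and would all come
from `H¹(K_v, E[p^k])`, of size `≤ B_v²`. (Restricted-module form.) [cite: GreenbergLNM1716, §3 Lemma 3.3 (p. 87)]
[cite: MilneADT2006, Ch. I §2, Thm. 2.8] -/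
theorem finite_galoisCohomology_one_primary_restrictField
    (hEP : localEulerPoincareCharacteristic (v.adicCompletion K)) (hpv : (p : 𝓞 K) ∉ v.asIdeal) :
    Finite (galoisCohomology (GaloisRep.restrictField (v.adicCompletion K) (primaryGaloisModule W p)) 1) := by
  by_contra hinf
  rw [not_finite_iff_infinite] at hinf
  obtain ⟨s, hs⟩ := Infinite.exists_subset_card_eq
    (galoisCohomology (GaloisRep.restrictField (v.adicCompletion K) (primaryGaloisModule W p)) 1)
    (Nat.card {Q : W.geomPrimaryTorsion p | ∀ σ : absoluteGaloisGroup (v.adicCompletion K),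
      GaloisRep.restrictField (v.adicCompletion K) (primaryGaloisModule W p) σ Q = Q} ^ 2 + 1)
  -- a common killing exponent `k ≥ 1`
  have hprim : ∀ Q : W.geomPrimaryTorsion p, ∃ k : ℕ, p ^ k • Q = 0 := fun Q ↦
    (AddCommGroup.mem_primaryComponent.mp Q.2).imp fun k hk ↦
      Subtype.ext (by rw [AddSubmonoidClass.coe_nsmul, hk, ZeroMemClass.coe_zero])
  choose kx hkx using fun x : galoisCohomology
      (GaloisRep.restrictField (v.adicCompletion K) (primaryGaloisModule W p)) 1 ↦
    exists_pow_nsmul_eq_zero_of_primary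
      (GaloisRep.restrictField (v.adicCompletion K) (primaryGaloisModule W p)) hprim x
  set k := s.sum kx + 1 with hk
  have hkill : ∀ x ∈ s, p ^ k • x = 0 := fun x hx ↦ by
    have hle : kx x ≤ k := (Finset.single_le_sum (fun _ _ ↦ Nat.zero_le _) hx).trans (Nat.le_succ _)
    rw [← pow_mul_pow_sub p hle, mul_comm, mul_smul, hkx x, smul_zero]
  have h := card_le_of_pow_nsmul_eq_zero W p v hEP hpv (k := k) (by omega) s hkill
  rw [hs] at h
  omega

/-- **`H¹(K_v, E[p^∞])` is finite at every finite place `v ∤ p`**, in the `toLocal` form of the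
Selmer-structure files (the local finiteness input of `RelaxedSelmerFinite` /
`levelLiftingAt_of_finite`), GIVEN Milne I Thm. 2.8 at `K_v`. [cite: GreenbergLNM1716, §3 Lemma 3.3 (p. 87)]
[cite: MilneADT2006, Ch. I §2, Thm. 2.8] -/
theorem finite_galoisCohomology_one_primary_toLocal
    (hEP : localEulerPoincareCharacteristic (v.adicCompletion K)) (hpv : (p : 𝓞 K) ∉ v.asIdeal) :
    Finite (galoisCohomology ((primaryGaloisModule W p).toLocal (Sum.inr v)) 1) :=
  finite_galoisCohomology_one_primary_restrictField W p v hEP hpv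

end Summit.BirchSwinnertonDyer.Rank1Residual.X11b.LocBridge

end
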